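import Summits.QuantumAdvantage.QuantumAdvantage.Theorems.HolonomyDialFlip

/-!
# HolonomyDial — SelfCorrect (cell decomp-qadv, seat lens-2, generation 13; supports item 26531 `ExactnessDial.PolyLossOddU3`)

§S second half: probe degrees (section EDeg), `vdec`/`decP`/`decV`, `win_data`, `decode_of_allWin` (kernel `decide`; keep the three `set_option`s), `deg_bump10`, `sep_hard_polylog`, **`binPointerLoss3 : BinPointerLoss3`**, `rungs_proved`, `closes_min`.

Split (≤ 400 lines, part 7/11) of the node file `HOME/decomp-qadv-lens-2/g13/HolonomyDial.lean` (v5, sha256 fb2c0281…,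
farm rc 0, no placeholders); declarations verbatim, namespace `Summit.QuantumAdvantage.QuantumAdvantage.Theorems.HolonomyDial`.
Record: NODE-g13.md.
-/

set_option linter.dupNamespace false

noncomputable section
open scoped Classical

namespace Summit.QuantumAdvantage.QuantumAdvantage.Theorems

open Finset
open Literature.Computability.QuantumComplexity Literature.Computability.QuantumComplexity.RingHLF
open Literature.Computability.MetaComplexity Literature.Computability.MetaComplexity.Smolensky
open Summit.QuantumAdvantage.AdviceFreeQNC0
open Summit.QuantumAdvantage.QuantumAdvantage.Theses (ExactnessDial.PolyLossOddU3 ExactnessDial.NoPerfectOdd3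
  ExactnessDial.NoPerfectConst3 ExactnessDial.MassStep3u ExactnessDial.OddToAll3 ExactnessDial.DPLift3
  ExactnessDial.MultiRingBridge3 ExactnessDial.closes)

namespace HolonomyDial

section SelfCorrect

variable {N : ℕ}

section EDeg
variable (h0 : 0 < N) (hN : 3 ≤ N) {D : ℕ} {f : CubeFn (ZMod 3) N} (hf : f ∈ lowDeg (ZMod 3) N D)
include hf

/-- Ring-game helper `e0P_mem` (lens-2 law package; see the module docstring). -/
theorem e0P_mem : e0P h0 f ∈ lowDeg (ZMod 3) N (D + D + 4) :=
  lowDeg_mono (by omega) (avoidOfSep_mem h0 hf)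

/-- Ring-game helper `e1P_mem` (lens-2 law package; see the module docstring). -/
theorem e1P_mem : e1P h0 hN f ∈ lowDeg (ZMod 3) N (D + D + 4) :=
  Submodule.sub_mem _ (lowDeg_mono (by omega) (comp_flip2_mem 1 2 (avoidOfSep_mem h0 hf)))
    (lowDeg_mono (show 2 ≤ D + D + 4 by omega) (Submodule.add_mem _ (one_mem_lowDeg 2) (U2P_mem hN)))

/-- Ring-game helper `e2P_mem` (lens-2 law package; see the module docstring). -/
theorem e2P_mem : e2P h0 hN f ∈ lowDeg (ZMod 3) N (D + D + 4) :=
  Submodule.sub_mem _ (lowDeg_mono (by omega) (comp_flip2_mem 2 3 (avoidOfSep_mem h0 hf)))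
    (lowDeg_mono (show 3 ≤ D + D + 4 by omega) (Submodule.add_mem _ (one_mem_lowDeg 3) (U3P_mem hN)))

/-- Ring-game helper `e3P_mem` (lens-2 law package; see the module docstring). -/
theorem e3P_mem : e3P h0 hN f ∈ lowDeg (ZMod 3) N (D + D + 4) :=
  Submodule.sub_mem _ (lowDeg_mono (by omega) (comp_flip2_mem 1 3 (avoidOfSep_mem h0 hf)))
    (lowDeg_mono (show 3 ≤ D + D + 4 by omega) (Submodule.add_mem _
      (Submodule.add_mem _ (Submodule.add_mem _ (one_mem_lowDeg 3) (one_mem_lowDeg 3))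
        (lowDeg_mono (by omega) (U2P_mem hN))) (U3P_mem hN)))

end EDeg

/-- Ring-game helper `e0P_apply` (lens-2 law package; see the module docstring). -/
theorem e0P_apply (h0 : 0 < N) (f : CubeFn (ZMod 3) N) (x : Fin N → Bool) :
    e0P h0 f x = (if decide (f x = 1) then 2 else if x ⟨0, h0⟩ = false then 0 else 1) := by
  rw [e0P, avoidOfSep_apply']

/-- Ring-game helper `e1P_apply` (lens-2 law package; see the module docstring). -/
theorem e1P_apply (h0 : 0 < N) (hN : 3 ≤ N) (f : CubeFn (ZMod 3) N) (x : Fin N → Bool) :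
    e1P h0 hN f x = (if decide (f (flip2 1 2 x) = 1) then 2 else if x ⟨0, h0⟩ = false then 0 else 1) -
      (1 + (if zpar x 2 then 1 else 0)) := by
  simp only [e1P, Pi.sub_apply, Pi.add_apply, Pi.one_apply, U2P_apply, avoidOfSep_apply',
    flip2_zero (show (1 : ℕ) ≠ 0 by decide) (show (2 : ℕ) ≠ 0 by decide) x h0]

/-- Ring-game helper `e2P_apply` (lens-2 law package; see the module docstring). -/
theorem e2P_apply (h0 : 0 < N) (hN : 3 ≤ N) (f : CubeFn (ZMod 3) N) (x : Fin N → Bool) :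
    e2P h0 hN f x = (if decide (f (flip2 2 3 x) = 1) then 2 else if x ⟨0, h0⟩ = false then 0 else 1) -
      (1 + (if zpar x 3 then 1 else 0)) := by
  simp only [e2P, Pi.sub_apply, Pi.add_apply, Pi.one_apply, U3P_apply, avoidOfSep_apply',
    flip2_zero (show (2 : ℕ) ≠ 0 by decide) (show (3 : ℕ) ≠ 0 by decide) x h0]

/-- Ring-game helper `e3P_apply` (lens-2 law package; see the module docstring). -/
theorem e3P_apply (h0 : 0 < N) (hN : 3 ≤ N) (f : CubeFn (ZMod 3) N) (x : Fin N → Bool) :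
    e3P h0 hN f x = (if decide (f (flip2 1 3 x) = 1) then 2 else if x ⟨0, h0⟩ = false then 0 else 1) -
      (1 + 1 + (if zpar x 2 then 1 else 0) + (if zpar x 3 then 1 else 0)) := by
  simp only [e3P, Pi.sub_apply, Pi.add_apply, Pi.one_apply, U2P_apply, U3P_apply, avoidOfSep_apply',
    flip2_zero (show (1 : ℕ) ≠ 0 by decide) (show (3 : ℕ) ≠ 0 by decide) x h0]

/-- «the value missed by four trits that cover the other two»: `vdec e₀ e₁ e₂ e₃`. -/
def vdec (a b c d : ZMod 3) : ZMod 3 :=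
  (a - b) * (a - b) * (-(a + b)) +
    (1 - (a - b) * (a - b)) * ((a - c) * (a - c) * (-(a + c)) + (1 - (a - c) * (a - c)) * (-(a + d)))

/-- the same formula on polynomials. -/
def decP (e0 e1 e2 e3 : CubeFn (ZMod 3) N) : CubeFn (ZMod 3) N :=
  (e0 - e1) * (e0 - e1) * (-(e0 + e1)) +
    (1 - (e0 - e1) * (e0 - e1)) * ((e0 - e2) * (e0 - e2) * (-(e0 + e2)) + (1 - (e0 - e2) * (e0 - e2)) * (-(e0 + e3)))

/-- Ring-game helper `decP_apply` (lens-2 law package; see the module docstring). -/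
theorem decP_apply (e0 e1 e2 e3 : CubeFn (ZMod 3) N) (x : Fin N → Bool) :
    decP e0 e1 e2 e3 x = vdec (e0 x) (e1 x) (e2 x) (e3 x) := by
  simp only [decP, vdec, Pi.add_apply, Pi.mul_apply, Pi.sub_apply, Pi.neg_apply, Pi.one_apply]

/-- Ring-game helper `decP_mem` (lens-2 law package; see the module docstring). -/
theorem decP_mem {E : ℕ} {e0 e1 e2 e3 : CubeFn (ZMod 3) N} (h0 : e0 ∈ lowDeg (ZMod 3) N E)
    (h1 : e1 ∈ lowDeg (ZMod 3) N E) (h2 : e2 ∈ lowDeg (ZMod 3) N E) (h3 : e3 ∈ lowDeg (ZMod 3) N E) :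
    decP e0 e1 e2 e3 ∈ lowDeg (ZMod 3) N (E + E + (E + E + E)) := by
  unfold decP
  have s01 : (e0 - e1) * (e0 - e1) ∈ lowDeg (ZMod 3) N (E + E) :=
    mul_mem_lowDeg_add (Submodule.sub_mem _ h0 h1) (Submodule.sub_mem _ h0 h1)
  have s02 : (e0 - e2) * (e0 - e2) ∈ lowDeg (ZMod 3) N (E + E) :=
    mul_mem_lowDeg_add (Submodule.sub_mem _ h0 h2) (Submodule.sub_mem _ h0 h2)
  have n01 : -(e0 + e1) ∈ lowDeg (ZMod 3) N E := Submodule.neg_mem _ (Submodule.add_mem _ h0 h1)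
  have n02 : -(e0 + e2) ∈ lowDeg (ZMod 3) N E := Submodule.neg_mem _ (Submodule.add_mem _ h0 h2)
  have n03 : -(e0 + e3) ∈ lowDeg (ZMod 3) N E := Submodule.neg_mem _ (Submodule.add_mem _ h0 h3)
  have t1 : (e0 - e1) * (e0 - e1) * (-(e0 + e1)) ∈ lowDeg (ZMod 3) N (E + E + E) := mul_mem_lowDeg_add s01 n01
  have t2 : (e0 - e2) * (e0 - e2) * (-(e0 + e2)) ∈ lowDeg (ZMod 3) N (E + E + E) := mul_mem_lowDeg_add s02 n02
  have t3 : (1 - (e0 - e2) * (e0 - e2)) * (-(e0 + e3)) ∈ lowDeg (ZMod 3) N (E + E + E) :=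
    mul_mem_lowDeg_add (Submodule.sub_mem _ (one_mem_lowDeg _) s02) n03
  have t4 : (1 - (e0 - e1) * (e0 - e1)) * ((e0 - e2) * (e0 - e2) * (-(e0 + e2)) +
      (1 - (e0 - e2) * (e0 - e2)) * (-(e0 + e3))) ∈ lowDeg (ZMod 3) N (E + E + (E + E + E)) :=
    mul_mem_lowDeg_add (Submodule.sub_mem _ (one_mem_lowDeg _) s01) (Submodule.add_mem _ t2 t3)
  exact Submodule.add_mem _ (lowDeg_mono (by omega) t1) t4

/-- **the decoder** steered by the separator `f`. -/
def decV (h0 : 0 < N) (hN : 3 ≤ N) (f : CubeFn (ZMod 3) N) : CubeFn (ZMod 3) N :=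
  decP (e0P h0 f) (e1P h0 hN f) (e2P h0 hN f) (e3P h0 hN f)

/-- Ring-game helper `decV_mem` (lens-2 law package; see the module docstring). -/
theorem decV_mem (h0 : 0 < N) (hN : 3 ≤ N) {D : ℕ} {f : CubeFn (ZMod 3) N} (hf : f ∈ lowDeg (ZMod 3) N D) :
    decV h0 hN f ∈ lowDeg (ZMod 3) N
      ((D + D + 4) + (D + D + 4) + ((D + D + 4) + (D + D + 4) + (D + D + 4))) :=
  decP_mem (e0P_mem h0 hf) (e1P_mem h0 hN hf) (e2P_mem h0 hN hf) (e3P_mem h0 hN hf)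

/-- the winning conditions of a pointer at `y`, in terms of `hol y` and `y_0`. -/
theorem win_data (h0 : 0 < N) (f : CubeFn (ZMod 3) N) (y : Fin N → Bool) (hw : BinPtrWin f y) :
    (decide (f y = 1) = true → hol y ≠ 2) ∧
      (decide (f y = 1) = false → (1 + (if y ⟨0, h0⟩ = false then 1 else 0) + hol y) % 3 ≠ 2) := by
  obtain ⟨h1, h2⟩ := hw
  rw [gCond_zero_iff'] at h1
  rw [gCond_one_iff' y h0] at h2
  exact ⟨fun hs => h1 (of_decide_eq_true hs), fun hs => h2 (of_decide_eq_false hs)⟩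

set_option synthInstance.maxHeartbeats 400000 in
set_option synthInstance.maxSize 4096 in
set_option maxHeartbeats 800000 in
/-- **SELF-CORRECTION**: if the pointer wins at the four probes of `x`, the decoder reads `hol(x)` (the final `decide`
is the 384-case coverage check «four refuted values cover both wrong hypotheses» fused with the correctness of `vdec`). -/
theorem decode_of_allWin (hN : 5 ≤ N) (h0 : 0 < N) (h3 : 3 ≤ N) (f : CubeFn (ZMod 3) N) (x : Fin N → Bool)
    (w0 : BinPtrWin f x) (w1 : BinPtrWin f (flip2 1 2 x)) (w2 : BinPtrWin f (flip2 2 3 x))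
    (w3 : BinPtrWin f (flip2 1 3 x)) : decV h0 h3 f x = ((hol x : ℕ) : ZMod 3) := by
  have d0 := win_data h0 f x w0
  have d1 := win_data h0 f _ w1
  have d2 := win_data h0 f _ w2
  have d3 := win_data h0 f _ w3
  rw [hol_flip12 x hN, flip2_zero (show (1 : ℕ) ≠ 0 by decide) (show (2 : ℕ) ≠ 0 by decide) x h0] at d1
  rw [hol_flip23 x hN, flip2_zero (show (2 : ℕ) ≠ 0 by decide) (show (3 : ℕ) ≠ 0 by decide) x h0] at d2
  rw [hol_flip13 x hN, flip2_zero (show (1 : ℕ) ≠ 0 by decide) (show (3 : ℕ) ≠ 0 by decide) x h0] at d3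
  rw [decV, decP_apply, e0P_apply, e1P_apply, e2P_apply, e3P_apply]
  have hlt : hol x < 3 := Nat.mod_lt _ (by norm_num)
  generalize decide (f x = 1) = s0 at d0 ⊢
  generalize decide (f (flip2 1 2 x) = 1) = s1 at d1 ⊢
  generalize decide (f (flip2 2 3 x) = 1) = s2 at d2 ⊢
  generalize decide (f (flip2 1 3 x) = 1) = s3 at d3 ⊢
  generalize hol x = H at d0 d1 d2 d3 hlt ⊢
  generalize x ⟨0, h0⟩ = x0 at d0 d1 d2 d3 ⊢
  generalize zpar x 2 = p2 at d1 d3 ⊢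
  generalize zpar x 3 = p3 at d2 d3 ⊢
  clear w0 w1 w2 w3
  revert d0 d1 d2 d3
  revert s0 s1 s2 s3 x0 p2 p3
  revert hlt H
  decide

/-- degree bookkeeping for the decoder: `5·(2·(log n)^c + 4) ≤ (log n)^{c+1}` once `n ≥ 2^30`. -/
theorem deg_bump10 (n c : ℕ) (hn : 2 ^ 30 ≤ n) :
    ((Nat.log 2 n) ^ c + (Nat.log 2 n) ^ c + 4) + ((Nat.log 2 n) ^ c + (Nat.log 2 n) ^ c + 4) +
      (((Nat.log 2 n) ^ c + (Nat.log 2 n) ^ c + 4) + ((Nat.log 2 n) ^ c + (Nat.log 2 n) ^ c + 4) +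
        ((Nat.log 2 n) ^ c + (Nat.log 2 n) ^ c + 4)) ≤ (Nat.log 2 n) ^ (c + 1) := by
  have hL : 30 ≤ Nat.log 2 n := Nat.le_log_of_pow_le (by norm_num) hn
  have hpos : 1 ≤ (Nat.log 2 n) ^ c := Nat.one_le_pow _ _ (by omega)
  rw [pow_succ]
  nlinarith

/-- **THEOREM S (self-correction count)**: for every `c`, for all large `n`, every degree-`(log₂ n)^c` {0,1}-pointer loses on
at least `2^{n-8}` odd patterns. -/
theorem sep_hard_polylog (c : ℕ) : ∃ n₀ : ℕ, ∀ n ≥ n₀, ∀ f : CubeFn (ZMod 3) n,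
    f ∈ lowDeg (ZMod 3) n ((Nat.log 2 n) ^ c) →
      2 ^ (n - 3) ≤ 32 * (univ.filter fun x : Fin n → Bool => OddZeros x ∧ ¬ BinPtrWin f x).card ∧ 128 ≤ n := by
  obtain ⟨n₀, hn₀⟩ := holDecode_hard_polylog (c + 1)
  refine ⟨max n₀ (2 ^ 30), fun n hn f hf => ?_⟩
  have hbig : 2 ^ 30 ≤ n := le_trans (le_max_right _ _) hn
  have h128 : 128 ≤ n := le_trans (by norm_num) hbig
  have h5 : 5 ≤ n := by omega
  have h0 : 0 < n := by omega
  have h3 : 3 ≤ n := by omega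
  have hV : decV h0 h3 f ∈ lowDeg (ZMod 3) n ((Nat.log 2 n) ^ (c + 1)) :=
    lowDeg_mono (deg_bump10 n c hbig) (decV_mem h0 h3 hf)
  obtain ⟨hdec, -⟩ := hn₀ n (le_trans (le_max_left _ _) hn) (decV h0 h3 f) hV
  refine ⟨le_trans hdec ?_, h128⟩
  have hcov : (univ.filter fun x : Fin n → Bool => OddZeros x ∧ decV h0 h3 f x ≠ ((hol x : ℕ) : ZMod 3)) ⊆
      (univ.filter fun x : Fin n → Bool => OddZeros x ∧ ¬ BinPtrWin f x) ∪
        (univ.filter fun x : Fin n → Bool => OddZeros x ∧ ¬ BinPtrWin f (flip2 1 2 x)) ∪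
        (univ.filter fun x : Fin n → Bool => OddZeros x ∧ ¬ BinPtrWin f (flip2 2 3 x)) ∪
        (univ.filter fun x : Fin n → Bool => OddZeros x ∧ ¬ BinPtrWin f (flip2 1 3 x)) := by
    intro x hx
    rw [mem_filter] at hx
    obtain ⟨-, hodd, hne⟩ := hx
    simp only [mem_union, mem_filter, mem_univ, true_and]
    by_cases w0 : BinPtrWin f x
    swap
    · exact Or.inl (Or.inl (Or.inl ⟨hodd, w0⟩))
    by_cases w1 : BinPtrWin f (flip2 1 2 x)
    swap
    · exact Or.inl (Or.inl (Or.inr ⟨hodd, w1⟩))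
    by_cases w2 : BinPtrWin f (flip2 2 3 x)
    swap
    · exact Or.inl (Or.inr ⟨hodd, w2⟩)
    by_cases w3 : BinPtrWin f (flip2 1 3 x)
    swap
    · exact Or.inr ⟨hodd, w3⟩
    exact absurd (decode_of_allWin h5 h0 h3 f x w0 w1 w2 w3) hne
  have hcard := le_trans (card_le_card hcov)
    (le_trans (card_union_le _ _) (Nat.add_le_add_right
      (le_trans (card_union_le _ _) (Nat.add_le_add_right (card_union_le _ _) _)) _))
  have e1 : (univ.filter fun x : Fin n → Bool => OddZeros x ∧ ¬ BinPtrWin f (flip2 1 2 x)).card =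
      (univ.filter fun x : Fin n → Bool => OddZeros x ∧ ¬ BinPtrWin f x).card := by
    convert card_filter_flip2 (N := n) (a := 1) (b := 2) (by norm_num) (by omega) (fun y => ¬ BinPtrWin f y)
  have e2 : (univ.filter fun x : Fin n → Bool => OddZeros x ∧ ¬ BinPtrWin f (flip2 2 3 x)).card =
      (univ.filter fun x : Fin n → Bool => OddZeros x ∧ ¬ BinPtrWin f x).card := by
    convert card_filter_flip2 (N := n) (a := 2) (b := 3) (by norm_num) (by omega) (fun y => ¬ BinPtrWin f y)
  have e3 : (univ.filter fun x : Fin n → Bool => OddZeros x ∧ ¬ BinPtrWin f (flip2 1 3 x)).card =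
      (univ.filter fun x : Fin n → Bool => OddZeros x ∧ ¬ BinPtrWin f x).card := by
    convert card_filter_flip2 (N := n) (a := 1) (b := 3) (by norm_num) (by omega) (fun y => ¬ BinPtrWin f y)
  rw [e1, e2, e3] at hcard
  omega

/-- **rung `BinPointerLoss3` PROVED** (exponent `C = 1`; in fact constant loss `2^{-7}`): SEPARATE is as hard as DECODE. -/
theorem binPointerLoss3 : BinPointerLoss3 := by
  refine ⟨1, fun c => ?_⟩
  obtain ⟨n₀, hn₀⟩ := sep_hard_polylog c
  refine ⟨n₀, fun n hn f hf => ?_⟩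
  obtain ⟨h, h128⟩ := hn₀ n hn f hf
  have hodd := card_odd_le (n := n) (by omega)
  have hsplit : (univ.filter fun x : Fin n → Bool => OddZeros x ∧ BinPtrWin f x).card +
      (univ.filter fun x : Fin n → Bool => OddZeros x ∧ ¬ BinPtrWin f x).card ≤
      (univ.filter fun x : Fin n → Bool => OddZeros x).card := by
    rw [← Finset.card_union_of_disjoint (Finset.disjoint_filter.2 fun x _ h1 h2 => h2.2 h1.2)]
    refine card_le_card fun x hx => ?_
    rw [mem_union, mem_filter, mem_filter] at hx
    rw [mem_filter]
    rcases hx with h | h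
    · exact ⟨h.1, h.2.1⟩
    · exact ⟨h.1, h.2.1⟩
  have e3 : 2 ^ (n - 1) = 4 * 2 ^ (n - 3) := by
    obtain ⟨k, rfl⟩ : ∃ k, n = k + 3 := ⟨n - 3, by omega⟩
    rw [Nat.add_sub_cancel, show k + 3 - 1 = k + 2 from rfl]; ring
  have hnat : 32 * (univ.filter fun x : Fin n → Bool => OddZeros x ∧ BinPtrWin f x).card + 2 ^ (n - 3) ≤
      32 * 2 ^ (n - 1) := by omega
  have hreal : (32 : ℝ) * ((univ.filter fun x : Fin n → Bool => OddZeros x ∧ BinPtrWin f x).card : ℝ) +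
      (2 : ℝ) ^ (n - 3) ≤ 32 * (2 : ℝ) ^ (n - 1) := by exact_mod_cast hnat
  have e3r : (2 : ℝ) ^ (n - 1) = 4 * (2 : ℝ) ^ (n - 3) := by exact_mod_cast e3
  rw [pow_one]
  have hn' : (1 : ℝ) / (n : ℝ) ≤ 1 / 128 := by
    apply one_div_le_one_div_of_le (by norm_num)
    exact_mod_cast h128
  have hpos : (0 : ℝ) ≤ (2 : ℝ) ^ (n - 3) := by positivity
  have hmul := mul_le_mul_of_nonneg_right hn' hpos
  rw [e3r]
  nlinarith

/-- the node equation one level down, now with BOTH lower rungs proved: `T ⟺ HolAvoidLoss3 ∧ AvoidLift3`,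
`HolAvoidLoss3 ⟹ BinPointerLoss3` (PROVED outright anyway) `⟹ HolDecodeLoss3` (PROVED). -/
theorem rungs_proved : BinPointerLoss3 ∧ HolDecodeLoss3 := ⟨binPointerLoss3, holDecodeLoss3⟩

/-- hence the first residual is settled too: `PointerLift3 ⟺ T`, and `closes` needs only `PointerLift3 ∧ DPLift3`. -/
theorem closes_min (hL : PointerLift3) (hD : ExactnessDial.DPLift3) :
    Summit.QuantumAdvantage.AdviceFreeQNC0.AdviceFreeQNC0Three :=
  closes binPointerLoss3 hL hD

end SelfCorrect

end HolonomyDial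

end Summit.QuantumAdvantage.QuantumAdvantage.Theorems
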